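import Summits.KontsevichZagierPeriods.Zeta5Search.Barrier.ConeGammaCuspPeriodGauge

/-!
# ζ(5) search — BARRIER: THE PAIR GAUGE IN CLOSED FORM — weighted pair functions, their greedy weights and Choquet values

HONEST FRAMING (cell `pub-zeta5`): systematic search; no irrationality claim unless kernel-certified. MODEL objects
under Brown–Zudilin's (28)+(30) accounting ([BZ22] = arXiv:2210.03391; (28) observed, not proved); nothing here is a
statement about `ζ(5)`, any `γ` of record, the cone's supremum (C2 OPEN), the cusp slope or any defect bound at a named
direction (DATA of the cell); S-E stays CONJECTURED; records in print UNMOVED. Prover P2 g32, item «THE WALL-WEIGHTED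
GAUGE» (INBOX 2026-08-27), file (1): PURE finite combinatorics (no saving function, no integral), continuing P2 g30's
`ConeGammaCuspGermGreedy` and P2 g31's `ConeGammaCuspPeriodGauge`.

Data: rates `ρ : Fin 28 → ℝ` pairwise distinct on all 28 forms (a generic reference), WEIGHTS `Λ k l` (one real number
per ordered pair; only the pairs with `ρ k < ρ l` are read), and the WEIGHTED PAIR FUNCTION
`q(A) = −Σ_{k,l ∈ A, ρ k < ρ l} Λ k l` (hypothesis shape `hq`, no definition). Flip times `c : Fin 28 → ℝ` of a second
displacement and a strict chain `d_0 < ⋯ < d_n` through them at interior indices, threshold sets `S_i = {k : c_k ≤ d_i}`.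
* `sum_sum_insert` — inserting one form into a double sum over `A × A`;
* **`pairFun_local_defect`** — the local defect of `q` behind `S` at the pair `{k,l}` is its weight, read in the order
  of `ρ`: `q(S+k) + q(S+l) − q(S) − q(S+k+l) = [ρ k < ρ l]·Λ k l + [ρ l < ρ k]·Λ l k`;
* **`pairFun_greedy_weight`** — the greedy weight of `q` at `k` in the order of `ρ` is `−Σ_{l : ρ k < ρ l} Λ k l`;
* `chain_single_jump`, **`pairFun_lovasz_value`** — the Choquet value of `q` along the chain of `c`:
  `Σ_i d_i (q(S_i) − q(S_{i−1})) = −Σ_{ρ k < ρ l} Λ k l · max(c_k, c_l)` (a pair enters a threshold set when its LATER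
  member does);
* **`pairGauge_closed_form`** — hence (Choquet value at `−c`) − (greedy functional of the order of `ρ` at `−c`)
  `= Σ_{ρ k < ρ l} Λ k l · max(c_l − c_k, 0)`: ONLY THE PAIRS INVERTED between the order of `ρ` and the order of `c`
  contribute, each its weight times its gap; `pairGauge_nonneg` (weights `≥ 0`), `pairGauge_eq_zero_of_refines` (no
  inverted pair);
* `choose2_eq_sum_pairs` — `C(|A|,2) = Σ_{k,l∈A} [ρ k < ρ l]` for generic `ρ`; whence **`gauge_closed_form`**: P2 g31's
  universal gauge of `ConeGammaCuspPeriodGauge` (the pair function `p = −C(|·|,2)`, all weights `1`) EQUALS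
  `Σ_{ρ k < ρ l} max(c_l − c_k, 0)` — the sum over the inverted pairs of their gaps (P2 g31's desk claim (L5), 88/88, now a
  theorem).
File (2) (`ConeGammaCuspPeriodWallGauge`) reads these on the cusp slope. NOT here: anything about `γ`, C2, S-E, `ζ(5)`, or
any named direction.
-/

noncomputable section

open Finset

namespace Summit.KontsevichZagierPeriods.Zeta5Search.Barrier.ConeGamma

/-! ### Double sums over `A × A` -/

/-- Inserting one form into a double sum over `A × A`:
`Σ_{x,y ∈ A+j} g x y = Σ_{x,y ∈ A} g x y + g j j + Σ_{y∈A} g j y + Σ_{x∈A} g x j`. -/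
theorem sum_sum_insert {A : Finset (Fin 28)} {j : Fin 28} (hj : j ∉ A) (g : Fin 28 → Fin 28 → ℝ) :
    ∑ x ∈ insert j A, ∑ y ∈ insert j A, g x y =
      ∑ x ∈ A, ∑ y ∈ A, g x y + g j j + ∑ y ∈ A, g j y + ∑ x ∈ A, g x j := by
  rw [Finset.sum_insert hj, Finset.sum_insert hj]
  have h : ∑ x ∈ A, ∑ y ∈ insert j A, g x y = ∑ x ∈ A, g x j + ∑ x ∈ A, ∑ y ∈ A, g x y := by
    rw [← Finset.sum_add_distrib]
    exact Finset.sum_congr rfl fun x _ => Finset.sum_insert hj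
  rw [h]
  ring

/-! ### The weighted pair function: local defects and greedy weights -/

/-- **THE LOCAL DEFECT OF A WEIGHTED PAIR FUNCTION IS ITS WEIGHT.** For `q(A) = −Σ_{k,l∈A, ρ k<ρ l} Λ k l` and
`k ≠ l ∉ S`: `q(S+k) + q(S+l) − q(S) − q(S+k+l) = [ρ k < ρ l]·Λ k l + [ρ l < ρ k]·Λ l k` (for `ρ` generic exactly one
bracket is `1`: the defect at the wall `{k,l}` is the weight of the pair read in the order of `ρ`, behind EVERY prefix). -/
theorem pairFun_local_defect {ρ : Fin 28 → ℝ} {Λ : Fin 28 → Fin 28 → ℝ} {q : Finset (Fin 28) → ℝ}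
    (hq : ∀ A, q A = -∑ k ∈ A, ∑ l ∈ A, if ρ k < ρ l then Λ k l else 0)
    {S : Finset (Fin 28)} {k l : Fin 28} (hkS : k ∉ S) (hlS : l ∉ S) (hkl : k ≠ l) :
    q (insert k S) + q (insert l S) - q S - q (insert k (insert l S)) =
      (if ρ k < ρ l then Λ k l else 0) + (if ρ l < ρ k then Λ l k else 0) := by
  have hk' : k ∉ insert l S := fun h => by
    rcases Finset.mem_insert.mp h with h | h
    · exact hkl h
    · exact hkS h
  rw [hq, hq, hq, hq, sum_sum_insert hk', sum_sum_insert hlS, sum_sum_insert hkS, Finset.sum_insert hlS,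
    Finset.sum_insert hlS]
  ring

/-- **THE GREEDY WEIGHT OF A WEIGHTED PAIR FUNCTION.** For `ρ` pairwise distinct on all 28 forms and every `k`:
`q(P≤(k)) − q(P<(k)) = −Σ_{l : ρ k < ρ l} Λ k l` (`P≤(k) = {l : ρ k ≤ ρ l} = P<(k) + k`; the new pairs are `{k,l}` with
`l` later than `k`). -/
theorem pairFun_greedy_weight {ρ : Fin 28 → ℝ} {Λ : Fin 28 → Fin 28 → ℝ} {q : Finset (Fin 28) → ℝ}
    (hq : ∀ A, q A = -∑ k ∈ A, ∑ l ∈ A, if ρ k < ρ l then Λ k l else 0)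
    (hgen : ∀ k l : Fin 28, k ≠ l → ρ k ≠ ρ l) (k : Fin 28) :
    q (Finset.univ.filter fun l => ρ k ≤ ρ l) - q (Finset.univ.filter fun l => ρ k < ρ l) =
      -∑ l, if ρ k < ρ l then Λ k l else 0 := by
  classical
  obtain ⟨hins, hnot⟩ := prefix_le_eq_insert (M := Finset.univ) (ρ := ρ)
    (fun k _ l _ hkl => hgen k l hkl) (Finset.mem_univ k)
  rw [hins, hq, hq, sum_sum_insert hnot]
  have h1 : (if ρ k < ρ k then Λ k k else 0) = 0 := if_neg (lt_irrefl _)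
  have h2 : ∑ x ∈ Finset.univ.filter (fun l => ρ k < ρ l), (if ρ x < ρ k then Λ x k else 0) = 0 :=
    Finset.sum_eq_zero fun x hx => if_neg (not_lt.mpr (Finset.mem_filter.mp hx).2.le)
  have h3 : ∑ y ∈ Finset.univ.filter (fun l => ρ k < ρ l), (if ρ k < ρ y then Λ k y else 0) =
      ∑ y, if ρ k < ρ y then Λ k y else 0 := by
    rw [Finset.sum_filter]
    refine Finset.sum_congr rfl fun y _ => ?_
    by_cases hy : ρ k < ρ y
    · rw [if_pos hy, if_pos hy]
    · rw [if_neg hy, if_neg hy]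
  rw [h1, h2, h3]
  ring

/-! ### The Choquet value of a weighted pair function along a chain -/

/-- **A single jump.** Along a strict chain `d`, a chain point `m = d_{i₀}` at an interior index contributes
`Σ_{0<i<n} d_i ([m ≤ d_i] − [m ≤ d_{i−1}]) = m`. -/
theorem chain_single_jump {n : ℕ} {d : ℕ → ℝ} (hmono : ∀ j < n, d j < d (j + 1)) {m : ℝ}
    (hm : ∃ i, 0 < i ∧ i < n ∧ d i = m) :
    ∑ i ∈ Finset.Ico 1 n, d i * ((if m ≤ d i then (1 : ℝ) else 0) - (if m ≤ d (i - 1) then 1 else 0)) = m := by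
  classical
  have h := sum_mul_eq_sum_chain_jumps ({0} : Finset (Fin 28)) (fun _ => (1 : ℝ)) (fun _ => m) hmono
    (fun _ _ => hm)
  rw [Finset.sum_singleton, one_mul] at h
  refine Eq.trans (Finset.sum_congr rfl fun i _ => ?_) h.symm
  simp only [Finset.filter_singleton]
  by_cases h1 : m ≤ d i <;> by_cases h2 : m ≤ d (i - 1) <;> simp [h1, h2]

/-- **THE CHOQUET VALUE OF A WEIGHTED PAIR FUNCTION.** If every flip time `c_k` is an interior point of the strict chain
`d`, then `Σ_{0<i<n} d_i (q(S_i) − q(S_{i−1})) = −Σ_{ρ k < ρ l} Λ k l · max(c_k, c_l)`, `S_i = {k : c_k ≤ d_i}`: a pair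
lies in a threshold set exactly when its later member does. -/
theorem pairFun_lovasz_value {ρ : Fin 28 → ℝ} {Λ : Fin 28 → Fin 28 → ℝ} {q : Finset (Fin 28) → ℝ}
    (hq : ∀ A, q A = -∑ k ∈ A, ∑ l ∈ A, if ρ k < ρ l then Λ k l else 0)
    (c : Fin 28 → ℝ) {n : ℕ} {d : ℕ → ℝ} (hmono : ∀ j < n, d j < d (j + 1))
    (hflip : ∀ k, ∃ i, 0 < i ∧ i < n ∧ d i = c k) :
    ∑ i ∈ Finset.Ico 1 n, d i *
        (q (Finset.univ.filter fun k => c k ≤ d i) - q (Finset.univ.filter fun k => c k ≤ d (i - 1))) =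
      -∑ k, ∑ l, if ρ k < ρ l then Λ k l * max (c k) (c l) else 0 := by
  classical
  obtain ⟨G, hG⟩ : ∃ G : Fin 28 → Fin 28 → ℝ, ∀ k l, G k l = if ρ k < ρ l then Λ k l else 0 :=
    ⟨_, fun _ _ => rfl⟩
  simp only [← hG] at hq
  -- `q` on a threshold set as an indicator double sum
  have hqS : ∀ t : ℝ, q (Finset.univ.filter fun k => c k ≤ t) =
      -∑ k, ∑ l, if max (c k) (c l) ≤ t then G k l else 0 := by
    intro t
    rw [hq, Finset.sum_filter]
    congr 1
    refine Finset.sum_congr rfl fun k _ => ?_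
    by_cases hk : c k ≤ t
    · rw [if_pos hk, Finset.sum_filter]
      refine Finset.sum_congr rfl fun l _ => ?_
      by_cases hl : c l ≤ t
      · rw [if_pos hl, if_pos (max_le hk hl)]
      · rw [if_neg hl, if_neg fun h => hl (le_of_max_le_right h)]
    · rw [if_neg hk]
      exact (Finset.sum_eq_zero fun l _ => if_neg fun h => hk (le_of_max_le_left h)).symm
  -- per pair: one jump at `max(c_k, c_l)`
  have hpair : ∀ k l, ∑ i ∈ Finset.Ico 1 n, d i *
      ((if max (c k) (c l) ≤ d i then G k l else 0) - (if max (c k) (c l) ≤ d (i - 1) then G k l else 0)) =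
        G k l * max (c k) (c l) := by
    intro k l
    have hm : ∃ i, 0 < i ∧ i < n ∧ d i = max (c k) (c l) := by
      rcases max_choice (c k) (c l) with h | h <;> rw [h]
      exacts [hflip k, hflip l]
    conv_rhs => rw [← chain_single_jump hmono hm]
    rw [Finset.mul_sum]
    refine Finset.sum_congr rfl fun i _ => ?_
    by_cases h1 : max (c k) (c l) ≤ d i <;> by_cases h2 : max (c k) (c l) ≤ d (i - 1) <;>
      simp only [h1, h2, if_true, if_false] <;> ring
  -- assemble
  have hstep : ∀ i ∈ Finset.Ico 1 n, d i *
      (q (Finset.univ.filter fun k => c k ≤ d i) - q (Finset.univ.filter fun k => c k ≤ d (i - 1))) =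
        -∑ k, ∑ l, d i * ((if max (c k) (c l) ≤ d i then G k l else 0) -
          (if max (c k) (c l) ≤ d (i - 1) then G k l else 0)) := by
    intro i _
    have e : ∑ k, ∑ l, (if max (c k) (c l) ≤ d (i - 1) then G k l else 0) -
        ∑ k, ∑ l, (if max (c k) (c l) ≤ d i then G k l else 0) =
        ∑ k, (∑ l, (if max (c k) (c l) ≤ d (i - 1) then G k l else 0) -
          ∑ l, (if max (c k) (c l) ≤ d i then G k l else 0)) := by
      rw [← Finset.sum_sub_distrib]
    rw [hqS, hqS, neg_sub_neg, e, Finset.mul_sum, ← Finset.sum_neg_distrib]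
    refine Finset.sum_congr rfl fun k _ => ?_
    rw [← Finset.sum_sub_distrib, Finset.mul_sum, ← Finset.sum_neg_distrib]
    exact Finset.sum_congr rfl fun l _ => by ring
  rw [Finset.sum_congr rfl hstep, Finset.sum_neg_distrib, Finset.sum_comm]
  congr 1
  refine Finset.sum_congr rfl fun k _ => ?_
  rw [Finset.sum_comm]
  refine Finset.sum_congr rfl fun l _ => ?_
  rw [hpair k l, hG]
  by_cases h : ρ k < ρ l
  · rw [if_pos h, if_pos h]
  · rw [if_neg h, if_neg h, zero_mul]

/-! ### The pair gauge in closed form -/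

/-- **THE PAIR GAUGE IN CLOSED FORM.** For `ρ` pairwise distinct on all 28 forms, the weighted pair function `q`, flip
times `c` and a strict chain through them at interior indices:
(Choquet value of `q` at `−c`) − (greedy functional of `q` in the order of `ρ`, at `−c`)
`= Σ_{ρ k < ρ l} Λ k l · max(c_l − c_k, 0)` — only the pairs INVERTED between the order of `ρ` (`k` before `l`) and
the order of the flip times (`l` before `k`) contribute, each its weight times its gap. -/
theorem pairGauge_closed_form {ρ : Fin 28 → ℝ} {Λ : Fin 28 → Fin 28 → ℝ} {q : Finset (Fin 28) → ℝ}
    (hq : ∀ A, q A = -∑ k ∈ A, ∑ l ∈ A, if ρ k < ρ l then Λ k l else 0)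
    (hgen : ∀ k l : Fin 28, k ≠ l → ρ k ≠ ρ l)
    (c : Fin 28 → ℝ) {n : ℕ} {d : ℕ → ℝ} (hmono : ∀ j < n, d j < d (j + 1))
    (hflip : ∀ k, ∃ i, 0 < i ∧ i < n ∧ d i = c k) :
    -(∑ i ∈ Finset.Ico 1 n, d i *
        (q (Finset.univ.filter fun k => c k ≤ d i) - q (Finset.univ.filter fun k => c k ≤ d (i - 1)))) -
      ∑ k, (q (Finset.univ.filter fun l => ρ k ≤ ρ l) - q (Finset.univ.filter fun l => ρ k < ρ l)) * (-c k) =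
      ∑ k, ∑ l, if ρ k < ρ l then Λ k l * max (c l - c k) 0 else 0 := by
  have h : ∀ k, (-∑ l, if ρ k < ρ l then Λ k l else 0) * (-c k) =
      ∑ l, if ρ k < ρ l then Λ k l * c k else 0 := by
    intro k
    rw [neg_mul_neg, Finset.sum_mul]
    refine Finset.sum_congr rfl fun l _ => ?_
    by_cases h : ρ k < ρ l
    · rw [if_pos h, if_pos h]
    · rw [if_neg h, if_neg h, zero_mul]
  have hw : ∑ k, (q (Finset.univ.filter fun l => ρ k ≤ ρ l) - q (Finset.univ.filter fun l => ρ k < ρ l)) * (-c k) =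
      ∑ k, ∑ l, if ρ k < ρ l then Λ k l * c k else 0 :=
    Finset.sum_congr rfl fun k _ => by rw [pairFun_greedy_weight hq hgen k]; exact h k
  rw [pairFun_lovasz_value hq c hmono hflip, neg_neg, hw, ← Finset.sum_sub_distrib]
  refine Finset.sum_congr rfl fun k _ => ?_
  rw [← Finset.sum_sub_distrib]
  refine Finset.sum_congr rfl fun l _ => ?_
  by_cases h : ρ k < ρ l
  · rw [if_pos h, if_pos h, if_pos h, ← mul_sub]
    congr 1
    rcases le_total (c k) (c l) with hkl | hkl
    · rw [max_eq_right hkl, max_eq_left (sub_nonneg.mpr hkl)]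
    · rw [max_eq_left hkl, max_eq_right (sub_nonpos.mpr hkl), sub_self]
  · rw [if_neg h, if_neg h, if_neg h, sub_zero]

/-- **The pair gauge is non-negative** as soon as the weights of the pairs `ρ k < ρ l` are. -/
theorem pairGauge_nonneg {ρ : Fin 28 → ℝ} {Λ : Fin 28 → Fin 28 → ℝ} (hΛ : ∀ k l, ρ k < ρ l → 0 ≤ Λ k l)
    (c : Fin 28 → ℝ) :
    0 ≤ ∑ k, ∑ l, if ρ k < ρ l then Λ k l * max (c l - c k) 0 else (0 : ℝ) :=
  Finset.sum_nonneg fun k _ => Finset.sum_nonneg fun l _ => by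
    by_cases h : ρ k < ρ l
    · rw [if_pos h]; exact mul_nonneg (hΛ k l h) (le_max_right _ _)
    · rw [if_neg h]

/-- **The pair gauge vanishes when no pair is inverted** (the order of the flip times is refined by the order of `ρ`:
`c_k < c_l ⇒ ρ l < ρ k`; in the rate language of file (2), `δ₀` refines `δ`). -/
theorem pairGauge_eq_zero_of_refines {ρ : Fin 28 → ℝ} (Λ : Fin 28 → Fin 28 → ℝ) {c : Fin 28 → ℝ}
    (href : ∀ k l : Fin 28, c k < c l → ρ l < ρ k) :
    ∑ k, ∑ l, (if ρ k < ρ l then Λ k l * max (c l - c k) 0 else (0 : ℝ)) = 0 :=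
  Finset.sum_eq_zero fun k _ => Finset.sum_eq_zero fun l _ => by
    by_cases h : ρ k < ρ l
    · rw [if_pos h]
      have hle : c l ≤ c k := not_lt.mp fun hlt => absurd (href k l hlt) (not_lt.mpr h.le)
      rw [max_eq_right (sub_nonpos.mpr hle), mul_zero]
    · rw [if_neg h]

/-! ### The unweighted case: P2 g31's universal gauge in closed form -/

/-- For `ρ` pairwise distinct on all 28 forms: `C(|A|,2) = Σ_{k,l ∈ A} [ρ k < ρ l]` (every 2-subset is counted once, in
the order of `ρ`). -/
theorem choose2_eq_sum_pairs {ρ : Fin 28 → ℝ} (hgen : ∀ k l : Fin 28, k ≠ l → ρ k ≠ ρ l) (A : Finset (Fin 28)) :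
    ((A.card.choose 2 : ℕ) : ℝ) = ∑ k ∈ A, ∑ l ∈ A, if ρ k < ρ l then (1 : ℝ) else 0 := by
  classical
  induction A using Finset.induction_on with
  | empty => simp
  | insert j A hj ih =>
    rw [Finset.card_insert_of_notMem hj, sum_sum_insert hj, ← ih, if_neg (lt_irrefl _), add_zero,
      Nat.choose_succ_succ, Nat.choose_one_right, Nat.cast_add, add_comm ((A.card : ℕ) : ℝ) _, add_assoc]
    congr 1
    rw [← Finset.sum_add_distrib, Finset.card_eq_sum_ones, Nat.cast_sum]
    refine Finset.sum_congr rfl fun y hy => ?_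
    have hne : ρ j ≠ ρ y := hgen j y fun h => hj (h ▸ hy)
    rcases lt_or_gt_of_ne hne with h | h
    · rw [if_pos h, if_neg (not_lt.mpr h.le)]; simp
    · rw [if_neg (not_lt.mpr h.le), if_pos h]; simp

/-- **P2 g31's UNIVERSAL GAUGE IN CLOSED FORM.** For `p(A) = −C(|A|,2)`, `ρ` pairwise distinct on all 28 forms, flip
times `c` and a strict chain through them at interior indices, the gauge of `ConeGammaCuspPeriodGauge`
(Choquet value of `p` at `−c` minus the greedy functional of `p` in the order of `ρ` at `−c`) EQUALS
`Σ_{ρ k < ρ l} max(c_l − c_k, 0)` — the sum, over the pairs inverted between the two orders, of their gaps (P2 g31's desk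
claim (L5), `gauge.py` 88/88). -/
theorem gauge_closed_form {p : Finset (Fin 28) → ℝ} (hp : ∀ A, p A = -((A.card.choose 2 : ℕ) : ℝ))
    {ρ : Fin 28 → ℝ} (hgen : ∀ k l : Fin 28, k ≠ l → ρ k ≠ ρ l)
    (c : Fin 28 → ℝ) {n : ℕ} {d : ℕ → ℝ} (hmono : ∀ j < n, d j < d (j + 1))
    (hflip : ∀ k, ∃ i, 0 < i ∧ i < n ∧ d i = c k) :
    -(∑ i ∈ Finset.Ico 1 n, d i *
        (p (Finset.univ.filter fun k => c k ≤ d i) - p (Finset.univ.filter fun k => c k ≤ d (i - 1)))) -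
      ∑ k, (p (Finset.univ.filter fun l => ρ k ≤ ρ l) - p (Finset.univ.filter fun l => ρ k < ρ l)) * (-c k) =
      ∑ k, ∑ l, if ρ k < ρ l then max (c l - c k) 0 else (0 : ℝ) := by
  have hq : ∀ A, p A = -∑ k ∈ A, ∑ l ∈ A, if ρ k < ρ l then (fun _ _ => (1 : ℝ)) k l else 0 := fun A => by
    rw [hp, choose2_eq_sum_pairs hgen A]
  rw [pairGauge_closed_form hq hgen c hmono hflip]
  refine Finset.sum_congr rfl fun k _ => Finset.sum_congr rfl fun l _ => ?_
  by_cases h : ρ k < ρ l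
  · rw [if_pos h, if_pos h, one_mul]
  · rw [if_neg h, if_neg h]

end Summit.KontsevichZagierPeriods.Zeta5Search.Barrier.ConeGamma

end
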